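import Mathlib
import Literature.NumberTheory.LFunctions.Zhang2022.SkeletonMeanValue
import Literature.NumberTheory.LFunctions.Zhang2022.RepairBedScale
import HarnessLib

/-!
# Zhang (2022), rescue bed (D-0124 (3)) Tier E/S: the §7 ARITHMETIC main-term objects of Proposition 7.1
# (`κ, κ̃, λ, λ₀ⱼ, κ̃₀ⱼ, λ̃₀ⱼ, ξ₀ⱼ`, `S_j`, the main term `α⁻¹(½S₁ + 2S₂ + 3/2S₃)𝔓`) and the coefficient sequences
# `a₁₁ … a₂₃` over an explicit Scale and an arbitrary coefficient `θ` in the `χ`-slot, with regression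

Topic `Literature/NumberTheory/LFunctions/Zhang2022` (Landau–Siegel audit tree; verdict-neutral).
Y. Zhang, *Discrete mean estimates and the Landau–Siegel zero*, arXiv:2211.02515v1 (2022)
[Zhang2022LandauSiegel] — **an unrefereed manuscript under adjudication; nothing in this file asserts or
denies any of its claims, and nothing here is a claim about Landau–Siegel zeros.**

Purpose (bed node group 1, spec bed1-E71: «Margin232 assembly via (8.23)/(9.7), the arithmetic side of Prop 7.1,
under θ ∈ {λ, χ_D} at a registered Scale»). The skeleton (`SkeletonMeanValue`) defines the §7 objects as functions
of the modulus `D` alone (`α = π/𝓛⁹`, `𝓛 = log D`, support bound `⌈PT⁻²⌉`, `𝔓`), and the sequences `a₁₁ … a₂₃`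
((8.8), (9.2), §10) with the character `χ` literal. A Tier-E/S bed row evaluates the SAME arithmetic at an explicit
scale (`RepairBedScale.Scale`: `α = π/log S.P`, shifts `b_j` from `(α, c′, S.L)`), an explicit support bound `N`,
an explicit normaliser, and with `χ` replaced by an arbitrary coefficient `θ : ℕ → ℂ` (`θ = λ`: the declared
(A)-emulation of rescue/BED.md §0.2 (H5); `θ = χ_D`: genuine data). This file gives those rows typed referents —
`b1S b2S b3S`, `betaJS`, `kappaZS`, `kappaTildeS`, `lamS`, `lamZeroS`, `kappaTildeZeroS`, `lamTildeZeroS`, `xiZeroS`,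
`SjS S c' N j a₁ a₂`, `mainMVS S c' N 𝔓 a₁ a₂`, `a11S … a23S S θ` — each with an `rfl` REGRESSION to the skeleton's
object at `S = Scale.zhang D`, `N = Skeleton.Nsupp D`, `𝔓 = frakP D`, `θ = χ`. The analytic objects of Prop 7.1
(`𝔠(s,ψ)`, `Θ₁`, the contour integral) are NOT re-scaled here (the bed's E71 rows test the ARITHMETIC side).
Pure definitions and `rfl`-regressions; no analytic content; no `instance`, no notation.

## References

* Y. Zhang, arXiv:2211.02515v1 (2022), §2 (2.13), §7 Prop. 7.1 pp. 13–15, §8 (8.8), §9 (9.2), §10 p. 20, §18 (18.3).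
  [cite: Zhang2022LandauSiegel, §§2, 7–10, 18]
-/

noncomputable section

open Complex Real ComplexConjugate

namespace Literature.NumberTheory.LFunctions.Zhang2022.Repair.Bed

section Arithmetic

variable (S : Scale) (c' : ℝ)

/-- `b₁ = α(1 − 5c′α𝓛)` at scale `S` (`β₁ = ib₁`, (2.13)). [cite: Zhang2022LandauSiegel, §2 (2.13)] -/
def b1S : ℝ := alpha S * (1 - 5 * c' * alpha S * S.L)

/-- `b₂ = 2α(1 + c′α𝓛)` at scale `S`. [cite: Zhang2022LandauSiegel, §2 (2.13)] -/
def b2S : ℝ := 2 * alpha S * (1 + c' * alpha S * S.L)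

/-- `b₃ = 3α(1 − c′α𝓛)` at scale `S`. [cite: Zhang2022LandauSiegel, §2 (2.13)] -/
def b3S : ℝ := 3 * alpha S * (1 - c' * alpha S * S.L)

/-- `β_j` with the §8 index convention (`j` read modulo `3`), at scale `S`. [cite: Zhang2022LandauSiegel, §8 p. 17] -/
def betaJS (j : ℕ) : ℂ :=
  if j % 3 = 1 then beta1 S c' else if j % 3 = 2 then beta2 S c' else beta3 S c'

/-- **`κ`** at scale `S`: `Σ κ(n)n^{−s} = ζ(s+β₁)ζ(s+β₂)ζ(s+β₃)/ζ(s)` (the tree's `MeanSquareMajorant.kappa` at the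
scale's shift sizes). [cite: Zhang2022LandauSiegel, §7 p. 14] -/
def kappaZS : ArithmeticFunction ℂ := MeanSquareMajorant.kappa (b1S S c') (b2S S c') (b3S S c')

open scoped Classical in
/-- **`κ̃(d;m,s) = Σ_{h∈𝔫(d),(h,m)=1} κ(dh)h^{−s}`** at scale `S` (a series; the bed truncates it and states the
tail). [cite: Zhang2022LandauSiegel, §7 p. 13] -/
def kappaTildeS (d m : ℕ) (s : ℂ) : ℂ :=
  ∑' h : ℕ, if h ∈ Skeleton.nset d ∧ Nat.Coprime h m then kappaZS S c' (d * h) / (h : ℂ) ^ s else 0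

/-- **`λ(m,s) = ∏_{q∣m} (1−q^{−s−β₁})(1−q^{−s−β₂})(1−q^{−s−β₃})/(1−q^{−s})`** at scale `S`.
[cite: Zhang2022LandauSiegel, §7 p. 13] -/
def lamS (m : ℕ) (s : ℂ) : ℂ :=
  ∏ q ∈ m.primeFactors,
    (1 - (q : ℂ) ^ (-(s + beta1 S c'))) * (1 - (q : ℂ) ^ (-(s + beta2 S c'))) *
      (1 - (q : ℂ) ^ (-(s + beta3 S c'))) / (1 - (q : ℂ) ^ (-s))

/-- `λ₀ⱼ(m) = λ(m, 1 − β_j)` at scale `S`. [cite: Zhang2022LandauSiegel, §7 p. 13] -/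
def lamZeroS (j m : ℕ) : ℂ := lamS S c' m (1 - betaJS S c' j)

/-- `κ̃₀ⱼ(d;m) = κ̃(d;m,1 − β_j)` at scale `S`. [cite: Zhang2022LandauSiegel, §7 p. 13] -/
def kappaTildeZeroS (j d m : ℕ) : ℂ := kappaTildeS S c' d m (1 - betaJS S c' j)

/-- `λ̃₀ⱼ(n,dr) = ∏_{q∣n,(q,dr)=1} λ₀ⱼ(q)` at scale `S`. [cite: Zhang2022LandauSiegel, §7 p. 13] -/
def lamTildeZeroS (j n dr : ℕ) : ℂ :=
  ∏ q ∈ n.primeFactors.filter (fun q => Nat.Coprime q dr), lamZeroS S c' j q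

/-- **`ξ₀ⱼ(n;d,r) = λ̃₀ⱼ(n,dr) Σ_{n=d₁k,(k,r)=1} κ̃₀ⱼ(d₁;drk)μ(k)k^{1−β_j}/φ(k)`** at scale `S`.
[cite: Zhang2022LandauSiegel, §7 p. 13] -/
def xiZeroS (j n d r : ℕ) : ℂ :=
  lamTildeZeroS S c' j n (d * r) *
    ∑ k ∈ n.divisors.filter (fun k => Nat.Coprime k r),
      kappaTildeZeroS S c' j (n / k) (d * r * k) * (ArithmeticFunction.moebius k : ℂ) *
        (k : ℂ) ^ (1 - betaJS S c' j) / (Nat.totient k : ℂ)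

/-- **`S_j(𝐚₁,𝐚₂)`** of Proposition 7.1 at scale `S`, with the support bound `N` explicit (plays `⌈PT⁻²⌉`):
`Σ_{d,r<N} |μ(r)|λ₀ⱼ(dr)/(drφ(r))·(Σ_{m<N} a₁(drm)m^{−(1−β_j)})·(Σ_{n<N} a₂(drn)ξ₀ⱼ(n;d,r)/n)`.
[cite: Zhang2022LandauSiegel, §7 Prop. 7.1] -/
def SjS (N : ℕ) (j : ℕ) (a₁ a₂ : ℕ → ℂ) : ℂ :=
  ∑ d ∈ Finset.Ico 1 N, ∑ r ∈ Finset.Ico 1 N,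
    ((ArithmeticFunction.moebius r).natAbs : ℂ) * lamZeroS S c' j (d * r) /
        ((d * r : ℕ) * (Nat.totient r : ℂ)) *
      (∑ m ∈ Finset.Ico 1 N, a₁ (d * r * m) / (m : ℂ) ^ (1 - betaJS S c' j)) *
      (∑ n ∈ Finset.Ico 1 N, a₂ (d * r * n) * xiZeroS S c' j n d r / (n : ℂ))

/-- **The main term `α⁻¹(½S₁ + 2S₂ + 3/2·S₃)·𝔓` of Proposition 7.1** at scale `S`, support bound `N`, normaliser `𝔓`
explicit. [cite: Zhang2022LandauSiegel, §7 Prop. 7.1] -/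
def mainMVS (N : ℕ) (frakP : ℝ) (a₁ a₂ : ℕ → ℂ) : ℂ :=
  (alpha S : ℂ)⁻¹ *
    (1 / 2 * SjS S c' N 1 a₁ a₂ + 2 * SjS S c' N 2 a₁ a₂ + 3 / 2 * SjS S c' N 3 a₁ a₂) * frakP

/-! ## The coefficient sequences with an arbitrary `θ` in the `χ`-slot -/

variable (θ : ℕ → ℂ)

/-- `a₁₁(n) = θ(n)(ϰ₁(n) + ι₂ϰ₂(n))` ((8.8) with `χ ↦ θ`; `A(𝐚₁₁) = H₁` when `θ = χ`). [cite: Zhang2022LandauSiegel, §8 (8.8)] -/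
def a11S (n : ℕ) : ℂ := θ n * (vk1 S n + iota2 * vk2 S n)

/-- `a₂₁(n) = conj a₁₁(n)` ((8.8)). [cite: Zhang2022LandauSiegel, §8 (8.8)] -/
def a21S (n : ℕ) : ℂ := conj (a11S S θ n)

/-- `a₁₂(n) = θ(n)(ῑ₃ϰ₃(n) + ῑ₄ϰ₂(n))` ((9.2) with `χ ↦ θ`; `A(𝐚₁₂) = H₂`). [cite: Zhang2022LandauSiegel, §9 (9.2)] -/
def a12S (n : ℕ) : ℂ := θ n * (conj iota3 * vk3 S n + conj iota4 * vk2 S n)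

/-- `a₂₂(n) = conj a₁₂(n)` ((9.2)). [cite: Zhang2022LandauSiegel, §9 (9.2)] -/
def a22S (n : ℕ) : ℂ := conj (a12S S θ n)

/-- `a₁₃(n) = θ(n)f̃(log n/log P)` (§10 p. 20 with `χ ↦ θ`; `A(𝐚₁₃) = J₁`). [cite: Zhang2022LandauSiegel, §10 p. 20] -/
def a13S (n : ℕ) : ℂ := θ n * (Skeleton.ftilde (Real.log n / Real.log S.P) : ℂ)

/-- `a₁₄(n) = θ(n)f̃(log n/log P + 0.004 − α̃)` (§10 p. 20; `A(𝐚₁₄) = J₂`). [cite: Zhang2022LandauSiegel, §10 p. 20] -/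
def a14S (n : ℕ) : ℂ := θ n * (Skeleton.ftilde (Real.log n / Real.log S.P + 0.004 - S.aT) : ℂ)

/-- `a₂₃ = a₁₃` (§18 p. 36, in `Θ₁(𝐚₂₃,𝐚₂₃)` for (18.3)). [cite: Zhang2022LandauSiegel, §18 (18.3)] -/
def a23S (n : ℕ) : ℂ := a13S S θ n

end Arithmetic

/-! ## Regression at Zhang's scale, support bound, normaliser and `θ = χ` -/

section Regression

variable (c' : ℝ) (D : ℕ) (χ : DirichletCharacter ℂ D) (j d m n r : ℕ) (s : ℂ) (a₁ a₂ : ℕ → ℂ)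

/-- `b₁` at Zhang's scale. [cite: Zhang2022LandauSiegel, §2 (2.13)] -/
theorem b1S_zhang : b1S (Scale.zhang D) c' = Skeleton.b1 c' D := rfl
/-- `b₂` at Zhang's scale. [cite: Zhang2022LandauSiegel, §2 (2.13)] -/
theorem b2S_zhang : b2S (Scale.zhang D) c' = Skeleton.b2 c' D := rfl
/-- `b₃` at Zhang's scale. [cite: Zhang2022LandauSiegel, §2 (2.13)] -/
theorem b3S_zhang : b3S (Scale.zhang D) c' = Skeleton.b3 c' D := rfl
/-- `β_j` at Zhang's scale. [cite: Zhang2022LandauSiegel, §8 p. 17] -/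
theorem betaJS_zhang : betaJS (Scale.zhang D) c' j = Skeleton.betaJ c' D j := rfl
/-- `κ` at Zhang's scale. [cite: Zhang2022LandauSiegel, §7 p. 14] -/
theorem kappaZS_zhang : kappaZS (Scale.zhang D) c' = Skeleton.kappaZ c' D := rfl
/-- `κ̃` at Zhang's scale. [cite: Zhang2022LandauSiegel, §7 p. 13] -/
theorem kappaTildeS_zhang : kappaTildeS (Scale.zhang D) c' d m s = Skeleton.kappaTilde c' D d m s := rfl
/-- `λ(m,s)` at Zhang's scale. [cite: Zhang2022LandauSiegel, §7 p. 13] -/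
theorem lamS_zhang : lamS (Scale.zhang D) c' m s = Skeleton.lam c' D m s := rfl
/-- `λ₀ⱼ` at Zhang's scale. [cite: Zhang2022LandauSiegel, §7 p. 13] -/
theorem lamZeroS_zhang : lamZeroS (Scale.zhang D) c' j m = Skeleton.lamZero c' D j m := rfl
/-- `κ̃₀ⱼ` at Zhang's scale. [cite: Zhang2022LandauSiegel, §7 p. 13] -/
theorem kappaTildeZeroS_zhang : kappaTildeZeroS (Scale.zhang D) c' j d m = Skeleton.kappaTildeZero c' D j d m := rfl
/-- `λ̃₀ⱼ` at Zhang's scale. [cite: Zhang2022LandauSiegel, §7 p. 13] -/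
theorem lamTildeZeroS_zhang : lamTildeZeroS (Scale.zhang D) c' j n d = Skeleton.lamTildeZero c' D j n d := rfl
/-- `ξ₀ⱼ` at Zhang's scale. [cite: Zhang2022LandauSiegel, §7 p. 13] -/
theorem xiZeroS_zhang : xiZeroS (Scale.zhang D) c' j n d r = Skeleton.xiZero c' D j n d r := rfl
/-- **`S_j` at Zhang's scale and support bound `⌈PT⁻²⌉` is the skeleton's `S_j`.** [cite: Zhang2022LandauSiegel, §7 Prop. 7.1] -/
theorem SjS_zhang : SjS (Scale.zhang D) c' (Skeleton.Nsupp D) j a₁ a₂ = Skeleton.Sj c' D j a₁ a₂ := rfl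
/-- **The Prop 7.1 main term at Zhang's scale, support bound and `𝔓` is the skeleton's `mainMV`.**
[cite: Zhang2022LandauSiegel, §7 Prop. 7.1] -/
theorem mainMVS_zhang :
    mainMVS (Scale.zhang D) c' (Skeleton.Nsupp D) (frakP D) a₁ a₂ = Skeleton.mainMV c' D a₁ a₂ := rfl



/-- `a₁₁` at Zhang's scale with `θ = χ`. [cite: Zhang2022LandauSiegel, §8 (8.8)] -/
theorem a11S_zhang : a11S (Scale.zhang D) (fun k => χ (k : ZMod D)) n = Skeleton.a11 χ n := rfl
/-- `a₂₁` at Zhang's scale with `θ = χ`. [cite: Zhang2022LandauSiegel, §8 (8.8)] -/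
theorem a21S_zhang : a21S (Scale.zhang D) (fun k => χ (k : ZMod D)) n = Skeleton.a21 χ n := rfl
/-- `a₁₂` at Zhang's scale with `θ = χ`. [cite: Zhang2022LandauSiegel, §9 (9.2)] -/
theorem a12S_zhang : a12S (Scale.zhang D) (fun k => χ (k : ZMod D)) n = Skeleton.a12 χ n := rfl
/-- `a₂₂` at Zhang's scale with `θ = χ`. [cite: Zhang2022LandauSiegel, §9 (9.2)] -/
theorem a22S_zhang : a22S (Scale.zhang D) (fun k => χ (k : ZMod D)) n = Skeleton.a22 χ n := rfl
/-- `a₁₃` at Zhang's scale with `θ = χ`. [cite: Zhang2022LandauSiegel, §10 p. 20] -/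
theorem a13S_zhang : a13S (Scale.zhang D) (fun k => χ (k : ZMod D)) n = Skeleton.a13 χ n := rfl
/-- `a₁₄` at Zhang's scale with `θ = χ`. [cite: Zhang2022LandauSiegel, §10 p. 20] -/
theorem a14S_zhang : a14S (Scale.zhang D) (fun k => χ (k : ZMod D)) n = Skeleton.a14 χ n := rfl
/-- `a₂₃` at Zhang's scale with `θ = χ`. [cite: Zhang2022LandauSiegel, §18 (18.3)] -/
theorem a23S_zhang : a23S (Scale.zhang D) (fun k => χ (k : ZMod D)) n = Skeleton.a23 χ n := rfl

end Regression

end Literature.NumberTheory.LFunctions.Zhang2022.Repair.Bed
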